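import Literature.AlgebraicGeometry.Motives.AbelianVarietyQuotientQuasiIdempotentImage
import Literature.AlgebraicGeometry.ComplexMultiplication.EndFieldCMOfSimpleOverNumberField
import HarnessLib

/-!
# A full-degree commutative reduced subalgebra of `End⁰_E(Im u₀)` over a number field `E` yields a SIMPLE CM QUOTIENT:
# [Liu2021] App. D §D.4 «`B_0` has complex multiplications by some subfield `M_0 ⊆ ℂ`», with `M_0` a CM field — unconditionally

Layer `Literature/AlgebraicGeometry/Motives`, namespace `Literature.AlgebraicGeometry.Motives.AbelianVariety`.
THEOREMS ONLY: no definition, no instance, no named fact, no `sorry` (net Literature debt 0).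

[Liu2021] App. D §D.4 (FJcycle.tex l. 5626–5627): «Using Hecke operators, we may find a surjective homomorphism
`φ : A_K → B` … Let `B_0` be some simple factor of `B` over `E`. Then `B_0` has complex multiplications by some subfield
`M_0 ⊆ ℂ`.»  [Shimura1998] §5.1 Props. 5–6 (pp. 38–39): for a simple `B_0`, `End_Q(B_0)` is a CM field of degree `2 dim B_0`.

The tree proved the quotient statement MODULO the Rosati/Albert step as a hypothesis `hG`
(`exists_cmQuotient_of_isCMField_of`, `AbelianVarietyQuotientQuasiIdempotentImage` §4) and, separately, the Rosati/Albert step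
itself over a number field (`ComplexMultiplication.isCMField_of_isSimple_forall`, `EndFieldCMOfSimpleOverNumberField`, via the
level Weil pairings).  This file is their one-line composition, so that consumers cite ONE name:

* **`exists_cmQuotient_numberField`** — for a prime `ℓ`, an abelian variety `A` over a number field `E`, a quasi-idempotent
  `u₀` (`a₀ ≠ 0`, `u₀ ≫ u₀ = a₀ • u₀`, `0 < dim Im u₀`) and a commutative reduced `R₀ ⊆ End⁰(Im u₀)` of degree `2 dim (Im u₀)`:
  there are a quasi-idempotent `u`, a quotient map `ψ : Im u₀ ⟶ Im u` with `toImage u₀ ≫ ψ = toImage u` and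
  `ᵗV_ℓ ψ ⊗ ℚ̄_ℓ` injective, and a CM FIELD `M ≅ End⁰(Im u)` of degree `2 dim (Im u)` — NO hypotheses left.

USE (cell `hodgecm-mathlib`, D-0151, crux `HLiu418` = stmt-HodgeConjecture-24832, d6 card S2′): this is (H2) `CMQuotientShape E`
for number fields `E`, by name.  The file moves no book (HC_CM is proved only modulo the 7 printed citations until rung 0 closes).

## References
* [Liu2021] Y. Liu, *Fourier–Jacobi cycles and arithmetic relative trace formula*, Camb. J. Math. 9 (2021), App. D §D.4
  (FJcycle.tex l. 5626–5627).
* [Shimura1998] G. Shimura, *Abelian Varieties with Complex Multiplication and Modular Functions* (1998), §5.1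
  Propositions 3–4 (p. 37), Proposition 5 (p. 38), Proposition 6 (p. 39).
* [MumfordAV1970] D. Mumford, *Abelian Varieties* (1970), §19 Thm. 1 and Cor. 2 (pp. 173–174), §21 Thm. 1.
-/

noncomputable section

open CategoryTheory NumberField

namespace Literature.AlgebraicGeometry.Motives.AbelianVariety

/-- **(H2) over a number field, unconditionally**: for every prime `ℓ`, abelian variety `A/E` (`E` a number field),
quasi-idempotent `u₀` (`a₀ ≠ 0`, `u₀ ≫ u₀ = a₀ • u₀`, `0 < dim Im u₀`) and commutative reduced `R₀ ⊆ End⁰(Im u₀)` of degree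
`2 dim (Im u₀)`, there are a quasi-idempotent `u` of `A`, a quotient map `ψ : Im u₀ ⟶ Im u` with `toImage u₀ ≫ ψ = toImage u` and
`ᵗV_ℓ ψ ⊗ ℚ̄_ℓ` injective, and a CM field `M ≅ End⁰(Im u)` of degree `2 dim (Im u)` — `exists_cmQuotient_of_isCMField_of` with its
Rosati/Albert hypothesis discharged by `ComplexMultiplication.isCMField_of_isSimple_forall`.
[cite: Liu2021, App. D §D.4 (FJcycle.tex l. 5626–5627)] [cite: Shimura1998, §5.1 Propositions 3–4 (p. 37) and Propositions 5–6 (pp. 38–39)]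
[cite: MumfordAV1970, §19 Thm. 1 and proof of Cor. 2 (pp. 173–174), §21 Thm. 1] -/
theorem exists_cmQuotient_numberField {E : Type} [Field E] [NumberField E] (ℓ : ℕ) [Fact ℓ.Prime] (A : AbelianVariety E)
    (u₀ : A ⟶ A) (a₀ : ℕ) (ha₀ : a₀ ≠ 0) (hu₀ : u₀ ≫ u₀ = a₀ • u₀) (hpos : 0 < (image u₀).dim)
    (R₀ : Subalgebra ℚ (image u₀).endAlgebra) (hcomm : ∀ x ∈ R₀, ∀ y ∈ R₀, x * y = y * x) (hred : IsReduced R₀)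
    (hdeg : Module.finrank ℚ R₀ = 2 * (image u₀).dim) :
    ∃ (u : A ⟶ A) (N : ℕ), N ≠ 0 ∧ u ≫ u = N • u ∧
      ∃ (ψ : image u₀ ⟶ image u), toImage u₀ ≫ ψ = toImage u ∧
        Function.Injective (((rationalTateModuleMap ℓ ψ).dualMap).baseChange (AlgebraicClosure ℚ_[ℓ])) ∧
        ∃ (M : Type) (_ : Field M) (_ : NumberField M) (_ : IsCMField M) (j : M →+* (image u).endAlgebra),
          Function.Bijective j ∧ Module.finrank ℚ M = 2 * (image u).dim :=
  exists_cmQuotient_of_isCMField_of Literature.AlgebraicGeometry.ComplexMultiplication.isCMField_of_isSimple_forall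
    ℓ A u₀ a₀ ha₀ hu₀ hpos R₀ hcomm hred hdeg

end Literature.AlgebraicGeometry.Motives.AbelianVariety

end
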